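import Literature.NumberTheory.EllipticCurves.Kobayashi2003.TowerSignedSelmerDual
import Literature.NumberTheory.EllipticCurves.Kobayashi2003.EtaSignedSelmerDualExistsProofs
import HarnessLib

/-!
# The WHOLE dual `X^ε(E/K_∞) = Hom(Sel^ε(E/K_∞), ℚ/ℤ)` EXISTS as a `Λ = ℤ_p[[Γ]]`-module
# (`T = γ − 1`): `Nonempty (Kobayashi2003.TowerSignedSelmerDualData W κ K₀ E γ ε)` — LITERATURE TWIN
# of §3 of the Summits-side `Rank1Residual/Additive/CyclotomicTowerSignedSelmerEtaSummand.lean`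
# (cell bsd-potss), word for word, for the Literature copy of the datum
# (`Kobayashi2003/TowerSignedSelmerDual.lean`, seat bsd-cm-k8i-ty g3) — proofs + one construction

Topic `NumberTheory/EllipticCurves`, sub-directory `Kobayashi2003` (namespace = path). Cell `bsd-cm`
(HOME `run/shared/lean/pub/bsd-cm/`), seat `bsd-cm-k8i-ty` g8 (literature-prover, typer lane;
typing-layer pattern D-0088(4): Literature cannot import `Summits`, so the existence theorem the
Summits tree proves for its field-identical original `Additive.TowerSignedSelmerDualData`
(`Additive.nonempty_towerSignedSelmerDualData`) is re-proved here for the Literature copy). HONEST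
FRAMING (cell bsd-cm): BSD is not proved by any of this; nothing is booked; no label moves.
PURPOSE: the two Literature named facts that quantify over a WHOLE-tower dual datum
`D : Kobayashi2003.TowerSignedSelmerDualData V κ K₀ ℚ_[p] γ ε` — Kobayashi 2003 Thm. 2.2 over
`ℤ_p[[Γ]]` (`thm22_towerSignedSelmerDual_finite_torsion`, sibling file) and Kitajima–Otsuki 2018 Main
Thm. 1.3 for `F = ℚ` (`KitajimaOtsuki2018.mainThm13_towerSignedSelmerDual_noFiniteSubmodule`) — are
thereby NON-VACUOUS inside the Literature layer (Kobayashi's setting `K = ℚ`, `K₀ = ℚ(μ_p)`: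
`nonempty_towerSignedSelmerDualData_cyclotomic`). The inputs (P) «every class of `H¹(K₀·K_∞, E[p^∞])`
is killed by a power of `p`» and (A2) «every class is fixed by some `conj_{γ^{p^a}}`» are the sibling
`EtaSignedSelmerDualExistsProofs.lean` (this seat), and `Sel^ε(E/K_∞)` is `conj_γ`-stable
(`conjH1_mem_towerSignedSelmerInfty`), so the generic `Λ`-structure `IwasawaDual.IsLocNil.module`
applies to `Hom(Sel^ε(E/K_∞), ℚ/ℤ)`. ONE definition (`conjTowerSignedSelmerInfty`, the restricted
conjugation — non-Prop plumbing) and ONE construction (`towerSignedSelmerDualData`); theorems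
otherwise; no instance; no named fact; no `sorry`; `#print axioms` standard.

References: [Kobayashi2003] S. Kobayashi, Invent. Math. 152 (2003), Def. 2.1 and Thm. 2.2 (p. 5),
§3 p. 5 (`G_∞ = Δ × Γ`); [KitajimaOtsuki2018] T. Kitajima, R. Otsuki, Tokyo J. Math. 41 (2018), §4
and Main Thm. 1.3 (the object); [GreenbergLNM1716] R. Greenberg, LNM 1716 (1999), §1 (p. 60).
-/

noncomputable section

open scoped Classical

universe u

namespace Literature.NumberTheory.EllipticCurves.Kobayashi2003

open WeierstrassCurve Literature.NumberTheory.EllipticCurves Literature.NumberTheory.GaloisRepresentations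
  Literature.NumberTheory.EllipticCurves.IwasawaAlgebra Literature.NumberTheory.EllipticCurves.IwasawaDual
  ZpExtension

section Dual

variable {K : Type u} [Field K] [NumberField K] {p : ℕ} [Fact p.Prime]
  (W : WeierstrassCurve K) (κ : ZpExtension K p) (K₀ : Type u) [Field K₀] [NumberField K₀]
  [Algebra K K₀] (E : Type u) [Field E] [Algebra K E] [(galRange (K := K) K₀).Normal] (ε : ℤˣ)

/-- `conj_γ` restricted to an endomorphism of `Sel^ε(E/K_∞)` (`conjH1_mem_towerSignedSelmerInfty`) —
the action through which `Λ = ℤ_p[[Γ]]` acts on `X^ε(E/K_∞)`. [cite: Kobayashi2003, Def. 2.1 (p. 5)] -/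
def conjTowerSignedSelmerInfty (γ : Field.absoluteGaloisGroup K) :
    AddMonoid.End (towerSignedSelmerInfty W κ K₀ E ε) :=
  ((W.conjH1 p (towerTopSubgroup κ K₀) γ).restrict (towerSignedSelmerInfty W κ K₀ E ε)).codRestrict
    (towerSignedSelmerInfty W κ K₀ E ε)
    fun s ↦ conjH1_mem_towerSignedSelmerInfty W κ K₀ E ε γ s.2

/-- Unfolding `conjTowerSignedSelmerInfty` (definitional). [cite: Kobayashi2003, Def. 2.1 (p. 5)] -/
@[simp]
theorem coe_conjTowerSignedSelmerInfty_apply (γ : Field.absoluteGaloisGroup K)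
    (s : towerSignedSelmerInfty W κ K₀ E ε) :
    ((conjTowerSignedSelmerInfty W κ K₀ E ε γ s : towerSignedSelmerInfty W κ K₀ E ε) :
        W.subgroupH1 p (towerTopSubgroup κ K₀)) = W.conjH1 p (towerTopSubgroup κ K₀) γ s :=
  rfl

/-- Powers of the restriction are restrictions of `conj_{γ^m}`. [cite: Kobayashi2003, Def. 2.1 (p. 5)] -/
theorem coe_conjTowerSignedSelmerInfty_pow_apply (γ : Field.absoluteGaloisGroup K) (m : ℕ)
    (s : towerSignedSelmerInfty W κ K₀ E ε) :
    ((((conjTowerSignedSelmerInfty W κ K₀ E ε γ) ^ m) s : towerSignedSelmerInfty W κ K₀ E ε) :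
        W.subgroupH1 p (towerTopSubgroup κ K₀)) = W.conjH1 p (towerTopSubgroup κ K₀) (γ ^ m) s := by
  induction m generalizing s with
  | zero => rw [pow_zero, pow_zero, AddMonoid.End.one_apply,
      W.conjH1_one_holds p (towerTopSubgroup κ K₀), AddMonoidHom.id_apply]
  | succ m ih =>
    rw [pow_succ, AddMonoid.End.coe_mul, Function.comp_apply, ih,
      coe_conjTowerSignedSelmerInfty_apply, pow_succ, W.conjH1_mul_holds p (towerTopSubgroup κ K₀),
      AddMonoidHom.comp_apply]

/-- **`Sel^ε(E/K_∞)` is `p`-primary and `T = conj_γ − 1` is locally nilpotent on it** for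
`γ ∈ Gal(K̄/K₀)` with `κ γ = 1` and `κ` onto on `Gal(K̄/K₀)` — (P) and (A2) of the sibling
`EtaSignedSelmerDualExistsProofs.lean` (`exists_pow_smul_subgroupH1_towerTop_eq_zero`,
`exists_conjH1_pow_prime_pow_towerTop_eq`) with `IwasawaDual.pow_mul_prime_pow_apply_eq_zero`; word
for word the sibling's `isLocNil_conjTowerSignedSelmerInftyEta_sub_one`.
[cite: GreenbergLNM1716, §1 (p. 60)] [cite: Kobayashi2003, §3 p. 5 (Γ ≅ ℤ_p, γ ∈ Γ)] -/
theorem isLocNil_conjTowerSignedSelmerInfty_sub_one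
    (hK₀ : ∀ x : Multiplicative ℤ_[p], ∃ g ∈ galRange (K := K) K₀, κ g = x)
    {γ : Field.absoluteGaloisGroup K} (hγ : κ.IsTopGenerator γ) (hγ₀ : γ ∈ galRange (K := K) K₀) :
    IwasawaDual.IsLocNil p (conjTowerSignedSelmerInfty W κ K₀ E ε γ - 1) := by
  have htor : ∀ s : towerSignedSelmerInfty W κ K₀ E ε, ∃ k : ℕ, p ^ k • s = 0 := fun s ↦ by
    obtain ⟨k, hk⟩ := exists_pow_smul_subgroupH1_towerTop_eq_zero W κ K₀
      (s : W.subgroupH1 p (towerTopSubgroup κ K₀))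
    exact ⟨k, Subtype.ext (by rw [AddSubgroupClass.coe_nsmul]; exact hk)⟩
  refine ⟨htor, fun s ↦ ?_⟩
  obtain ⟨a, ha⟩ := exists_conjH1_pow_prime_pow_towerTop_eq W κ K₀ hK₀ hγ hγ₀
    (s : W.subgroupH1 p (towerTopSubgroup κ K₀))
  obtain ⟨k, hk⟩ := htor s
  have hφ : ((conjTowerSignedSelmerInfty W κ K₀ E ε γ) ^ p ^ a) s = s :=
    Subtype.ext (by rw [coe_conjTowerSignedSelmerInfty_pow_apply]; exact ha)
  exact ⟨k * p ^ a, IwasawaDual.pow_mul_prime_pow_apply_eq_zero (Fact.out : p.Prime) _ a hφ hk⟩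

/-- **The Iwasawa module `X^ε(E/K_∞) = Hom(Sel^ε(E/K_∞), ℚ/ℤ)` with its `Λ`-module structure**
(`T = γ − 1`, constants through `ℤ_p → ℤ/pᵏ`) packaged as a `TowerSignedSelmerDualData W κ K₀ E γ ε`
(`X = (Sel^ε_∞ →+ AddCircle 1)`, `toDual = id`, module structure `IsLocNil.module`) — word for word
the Summits `Additive.towerSignedSelmerDualData` and the sibling's `etaSignedSelmerDualData`.
[cite: GreenbergLNM1716, §1 (p. 60)] [cite: Kobayashi2003, Def. 2.1 (p. 5)] -/
def towerSignedSelmerDualData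
    (hK₀ : ∀ x : Multiplicative ℤ_[p], ∃ g ∈ galRange (K := K) K₀, κ g = x)
    {γ : Field.absoluteGaloisGroup K} (hγ : κ.IsTopGenerator γ) (hγ₀ : γ ∈ galRange (K := K) K₀) :
    TowerSignedSelmerDualData W κ K₀ E γ ε :=
  { X := towerSignedSelmerInfty W κ K₀ E ε →+ AddCircle (1 : ℚ)
    module := (isLocNil_conjTowerSignedSelmerInfty_sub_one W κ K₀ E ε hK₀ hγ hγ₀).module
    conj_mem := fun s hs ↦ conjH1_mem_towerSignedSelmerInfty W κ K₀ E ε γ hs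
    toDual := AddMonoidHom.id _
    bijective := Function.bijective_id
    toDual_T_smul := fun x s ↦ by
      show (isLocNil_conjTowerSignedSelmerInfty_sub_one W κ K₀ E ε hK₀ hγ hγ₀).smulFun
          PowerSeries.X x s = x _ - x s
      rw [(isLocNil_conjTowerSignedSelmerInfty_sub_one W κ K₀ E ε hK₀ hγ hγ₀).smulFun_X_apply,
        IwasawaDual.End_sub_apply, AddMonoid.End.one_apply, map_sub]
      rfl
    toDual_C_smul := fun c x s k hk ↦ by
      show (isLocNil_conjTowerSignedSelmerInfty_sub_one W κ K₀ E ε hK₀ hγ hγ₀).smulFun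
          (PowerSeries.C c) x s = _
      exact (isLocNil_conjTowerSignedSelmerInfty_sub_one W κ K₀ E ε hK₀ hγ hγ₀).smulFun_C_apply
        c x hk }

/-- **Existence of the WHOLE dual datum**: for `γ ∈ Gal(K̄/K₀)` a topological generator and `κ`
onto on `Gal(K̄/K₀)`, `TowerSignedSelmerDualData W κ K₀ E γ ε` is inhabited — NON-VACUITY of every
statement "`∀ D : TowerSignedSelmerDualData …`" (Kobayashi's Thm. 2.2 over `ℤ_p[[Γ]]`,
Kitajima–Otsuki's Main Thm. 1.3 for `F = ℚ`, as vendored). [cite: GreenbergLNM1716, §1 (p. 60)]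
[cite: Kobayashi2003, Def. 2.1 and Thm. 2.2 (p. 5; the object only)] -/
theorem nonempty_towerSignedSelmerDualData
    (hK₀ : ∀ x : Multiplicative ℤ_[p], ∃ g ∈ galRange (K := K) K₀, κ g = x)
    {γ : Field.absoluteGaloisGroup K} (hγ : κ.IsTopGenerator γ) (hγ₀ : γ ∈ galRange (K := K) K₀) :
    Nonempty (TowerSignedSelmerDualData W κ K₀ E γ ε) :=
  ⟨towerSignedSelmerDualData W κ K₀ E ε hK₀ hγ hγ₀⟩

/-- Every datum `D : TowerSignedSelmerDualData W κ K₀ E γ ε` is a dual pair for `ψ = conj_γ − 1` on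
`Sel^ε(E/K_∞)` (`toDual_T_smul`, `toDual_C_smul`, local nilpotence under (A2)'s hypotheses) — the
interface of the tree's generic `Λ`-module bookkeeping (`IwasawaDual.IsDualPair`).
[cite: GreenbergLNM1716, §1 (p. 60)] -/
theorem TowerSignedSelmerDualData.isDualPair {γ : Field.absoluteGaloisGroup K}
    (D : TowerSignedSelmerDualData W κ K₀ E γ ε)
    (hK₀ : ∀ x : Multiplicative ℤ_[p], ∃ g ∈ galRange (K := K) K₀, κ g = x)
    (hγ : κ.IsTopGenerator γ) (hγ₀ : γ ∈ galRange (K := K) K₀) :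
    IwasawaDual.IsDualPair p (conjTowerSignedSelmerInfty W κ K₀ E ε γ - 1) D.toDual where
  bijective := D.bijective
  T_smul x s := by
    rw [D.toDual_T_smul, IwasawaDual.End_sub_apply, AddMonoid.End.one_apply, map_sub]
    rfl
  C_smul c x s k hk := D.toDual_C_smul c x s k hk
  locNil := isLocNil_conjTowerSignedSelmerInfty_sub_one W κ K₀ E ε hK₀ hγ hγ₀

/-- **Existence in the tame case** `p ∤ [K₀ : K]` (`K₀/K` Galois): for any topological generator
`γ ∈ Gal(K̄/K₀)` the whole dual datum exists (the sibling's
`kappa_surjOn_galRange_of_coprime_finrank`). [cite: Kobayashi2003, §3 p. 5] [cite: GreenbergLNM1716, §1 (p. 60)] -/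
theorem nonempty_towerSignedSelmerDualData_of_coprime_finrank [IsGalois K K₀]
    (hcop : Nat.Coprime p (Module.finrank K K₀)) {γ : Field.absoluteGaloisGroup K}
    (hγ : κ.IsTopGenerator γ) (hγ₀ : γ ∈ galRange (K := K) K₀) :
    Nonempty (TowerSignedSelmerDualData W κ K₀ E γ ε) :=
  nonempty_towerSignedSelmerDualData W κ K₀ E ε
    (kappa_surjOn_galRange_of_coprime_finrank κ K₀ hcop) hγ hγ₀

end Dual

/-! ## Kobayashi's setting verbatim: `K = ℚ`, `K₀ = ℚ(μ_p)` -/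

section Cyclotomic

variable {p : ℕ} [Fact p.Prime] (W : WeierstrassCurve ℚ) (κ : ZpExtension ℚ p)
  (K₀ : Type) [Field K₀] [NumberField K₀] [Algebra ℚ K₀] [IsCyclotomicExtension {p} ℚ K₀]
  (E : Type) [Field E] [Algebra ℚ E] (ε : ℤˣ)

/-- **Kobayashi's WHOLE `X^ε(E/K_∞)` over `K_∞ = ℚ(μ_{p^∞})` as a `ℤ_p[[Γ]]`-module EXISTS in the
tree's sense** for `K = ℚ`, `K₀ = ℚ(μ_p)`, any `κ`, `E`, `ε`, and any topological generator
`γ ∈ Gal(ℚ̄/ℚ(μ_p))` (`[ℚ(μ_p) : ℚ] = p − 1` is prime to `p`: the sibling's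
`kappa_surjOn_galRange_cyclotomic`). The object of Thm. 2.2 and of Kitajima–Otsuki's Main Thm. 1.3
(`F = ℚ`); those theorems themselves are NOT asserted here.
[cite: Kobayashi2003, Def. 2.1 and Thm. 2.2 (p. 5; the object only), §3 p. 5]
[cite: KitajimaOtsuki2018, §4 and Main Thm. 1.3 (the object only)] -/
theorem nonempty_towerSignedSelmerDualData_cyclotomic [(galRange (K := ℚ) K₀).Normal]
    {γ : Field.absoluteGaloisGroup ℚ} (hγ : κ.IsTopGenerator γ) (hγ₀ : γ ∈ galRange (K := ℚ) K₀) :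
    Nonempty (TowerSignedSelmerDualData W κ K₀ E γ ε) :=
  nonempty_towerSignedSelmerDualData W κ K₀ E ε (kappa_surjOn_galRange_cyclotomic κ K₀) hγ hγ₀

end Cyclotomic

end Literature.NumberTheory.EllipticCurves.Kobayashi2003

end
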